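import Summits.BirchSwinnertonDyer.Rank1Residual.X11b.RouteR1BDPExists
import Summits.BirchSwinnertonDyer.Rank1Residual.X11b.HalvesReceptacle
import Summits.BirchSwinnertonDyer.Rank1Residual.X11b.AnticyclotomicLogLinks
import Literature.NumberTheory.EllipticCurves.PAdicBSDSplitMultiplicativeProofs
import Literature.NumberTheory.EllipticCurves.PAdicLFunctionNonsplitMultiplicativeExistenceProofs
import HarnessLib

/-!
# X11b, route R1 — HALVES, pointwise part (every `p`): the shapes (H2) value at `𝟙` and (H3) IMC
# equality over a BDP frame `L ∈ R₀⟦T⟧`, and the algebra of EQUALITY giving the composite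
# `IMCWaldspurgerOnTreeAt` from CTL₀ ∧ H3 ∧ H2

HONEST FRAMING (cell `b2b-bsdres`, run/shared/lean/b2b/bsd-rank1-residual/, verbatim in every
file): the goal of the cell is to DELETE the COMBINATION-SHAPED residual classes of the
Birch–Swinnerton-Dyer formula for ALL analytic-rank `≤ 1` elliptic curves over `ℚ` — "full BSD
formula for every rank `≤ 1` curve in class `C`" assembled STRICTLY from published theorems — so
that the rank-`≤ 1` remainder becomes exactly the CONSTRUCTION-SHAPED classes, which are TYPED
(missing-input `Prop`s), NOT attempted. This is not "finishing BSD". Sub-cell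
`b2b-bsdres-multr1-p1` (X11b, route R1); a RESEARCH ROUTE; no claim beyond the stated class; X11b
stays CONSTRUCTION-SHAPED; nothing here changes a label; no named fact (definitions with bodies —
`Prop`-valued SHAPES — and theorems; every result using the OPEN shape is CONDITIONAL; no `sorry`). Namespace/shape treaty with team x11b3 (OWNERS A6.3 (2),
2026-08-21T07:09Z): these are the `p ≥ 5`, route-R1, EQUALITY-shaped halves under `X11b.R1.` names;
x11b3's `p = 3` one-sided halves (`Three.…₃`, S10) are neither imported nor restated.

## What this file does (gen 20)

Gen 8 typed THE open input of route R1 at a datum as the COMPOSITE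
`IMCWaldspurgerOnTreeAt p κ 𝔭 γ ι P := ∃ n, XAc.HasCharValuationAt … n ∧ n = 2·(ord_p log_ω P − 1)`
(`AnticyclotomicLogLinks.lean`), Castella's `L_p(f)(𝟙)` being ELIMINATED between erratum Thm. 1.1
and Cas18 Thm. 3.2 because the tree had no `L_p(f)`. The tree now has the object
(`IsBDPLFunction`, lit-prim-2) and its EXISTENCE at `p ≥ 5` on semistable `E` is the registered
PUBLISHED fact A206, instantiated on R1's data in `RouteR1BDPExists.lean` (H1). Here:

* §1 receptacle (every `p`): the tree's `X11b/HalvesReceptacle.lean` (`Halves.toUnr : ℤ_[p] →+* R₀`,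
  `‖R₀‖ ≤ 1`, units of norm `1`, `Halves.logOmega`, shared with team x11b3) is IMPORTED; here only
  `‖1 − a·p⁻¹‖ = p` for `p ∤ a` (`R1.norm_one_sub_div_eq`).
* §2 the ALGEBRA OF EQUALITY (every `p`): if `f ∈ Λ` has `f(0) ≠ 0`, `(f)·R₀⟦T⟧ = (L)` and
  `L(0) = u·((1 − a/p)·x)²` with `u ∈ R₀ˣ`, `p ∤ a`, then `x ≠ 0` and `ord_p f(0) = 2·(ord_p x − 1)`
  EXACTLY (`R1.valuation_constantCoeff_eq_of_span_map_eq`) — by norms in `ℂ_p`: the cofactor is a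
  UNIT of `R₀⟦T⟧`, so `‖f(0)‖ = ‖L(0)‖ = p²‖x‖²`.
* §3 pointwise ON TREE OBJECTS (every `p`, every `ι : K →+* ℚ_p`; `log_{ω_E} P = Halves.logOmega W p ι P
  ∈ ℚ_p`, whose `ord_p` is `padicLogOrd`), the two SHAPES at a frame `L`:
  **`R1.BDPValueAtOneOnTreeAt`** (H2: `∃ u ∈ R₀ˣ, L(𝟙) = u·((1 − a_p(E) p⁻¹)·log_ω P)²`, Cas18
  Thm. 3.2 — PUB shape) and **`R1.IMCEqOnTreeAt`** (H3: `Ch_Λ(X_ac^∅(E[p^∞]))·R₀⟦T⟧ = (L)`, erratum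
  Thm. 1.1 — OPEN shape), and **`R1.imcWaldspurgerOnTreeAt_of_halves`**: CTL₀ (`HasCharValuationAt
  n`, a THEOREM on route R1 since gen 18) ∧ H3 ∧ H2 ⟹ `IMCWaldspurgerOnTreeAt` with the same `n`.
* (§4, companion file `RouteR1Halves.lean`) CLASS LEVEL at `p ≥ 5`: the typed inputs **`R1.BDPValueOnTree W p`** (H2 at every R1 datum,
  every anticyclotomic `(κ, γ)`, every embedding datum `ι'` and every frame
  `IsBDPLFunction ι' 𝔭_{ι'} κ γ f Ω_K Ω_p L`) and **`R1.IMCEqOnTree W p`** (H3 likewise), and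
  **`R1.openInputOnTreeAt_of_halves`**: on a SEMISTABLE pair, `R1OpenInputOnTreeAt W p` ⟸ H2-typed
  ∧ H3-typed, given the PUBLISHED facts `hBDP` (A206, H1), `hmod`, `hGZK` and the CITED facts of
  the control theorem (`hPT hPT2 hEP hcd hBr`) — at EVERY degree-one `𝔭 ∣ p`, because every such
  `𝔭` is `𝔭_ι` or `𝔭_{ι ∘ conj}` (`eq_primeOfEmbeddingDatum_or_eq_trans_starRingAut`); hence
  **`R1.bsdp_of_halves_final`**: `BSD_p` on semistable `R1Population ∩ {r_an = 1}` from 8 PUB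
  (incl. A206) + 5 cited + H2 (PUB shape) + H3 (OPEN), for a fixed embedding datum `ι` (through
  the tightness theorem `R1.openInputOnTreeAt_iff_bsdp_final` of gen 19).

So at `p ≥ 5` on semistable R1 pairs the route's OPEN input is EXACTLY erratum Thm. 1.1 for
Castella's published `L_p(f)` — "`Ch_Λ(X_ac(E[p^∞]))Λ_{R₀} = (L_p(f))`" (⇐ [FW21, Thm. 4.41],
PREPRINT) — and the value formula is a separately typed PUBLISHED shape (Cas18 Thm. 3.2, whose
printed proof at `p ∣ N` is [cas-split] Thm. 2.11, split `p ≥ 5`: x11b3 REFEREE §2 H3/H4 police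
rows record the non-split reading). CONDITIONAL; X11b stays CONSTRUCTION-SHAPED; no label change.

References: [Castella2018] Thm. 2.3, Thm. 3.1, Thm. 3.2, §5 (arXiv:1704.06608 pp. 5, 9, 12);
[Castella2018Erratum] Thm. 1.1 (p. 1); [FouquetWan2021] Thm. 4.41; [CastellaHsieh2018] §3.3.
-/

noncomputable section

open scoped Classical

open WeierstrassCurve NumberField IsDedekindDomain Field PowerSeries
open Literature.NumberTheory.EllipticCurves
open Literature.NumberTheory.EllipticCurves.ModularForms
open Literature.NumberTheory.EllipticCurves.Rank1Residual
open Literature.NumberTheory.GaloisRepresentations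
open Summit.BirchSwinnertonDyer.Rank1Residual.X11b.AcSelmer
open Summit.BirchSwinnertonDyer.Rank1Residual.X11b.CongruenceLimit
open Summit.BirchSwinnertonDyer.Rank1Residual.X11b.Halves

namespace Summit.BirchSwinnertonDyer.Rank1Residual.X11b

/-! ### §1 One receptacle fact not in `HalvesReceptacle.lean` (every prime `p`)

The receptacle `R₀ ⊂ ℂ_p` — `‖R₀‖ ≤ 1`, units of norm `1`, `Halves.toUnr : ℤ_[p] →+* R₀` — is the
tree's `X11b/HalvesReceptacle.lean` (team x11b3, r2/p7: shared infrastructure, every `p`), imported. -/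

section Receptacle

variable (p : ℕ) [Fact p.Prime]

/-- **Euler-factor bookkeeping, exact form**: `‖1 − a·p⁻¹‖ = p` in `ℚ_p` whenever `p ∤ a` — e.g.
`a = a_p(E) = ±1` at a prime of multiplicative reduction, `ord_p(1 − a_p p⁻¹) = −1` EXACTLY (Cas18,
proof of Thm. 3.2: "`p⁻¹(p − a_p)`"). [cite: Castella2018, proof of Thm. 3.2 (arXiv:1704.06608 p. 9)] -/
theorem R1.norm_one_sub_div_eq {a : ℤ} (ha : ¬ (p : ℤ) ∣ a) :
    ‖(1 : ℚ_[p]) - (a : ℚ_[p]) * (p : ℚ_[p])⁻¹‖ = p := by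
  have hp : (p : ℚ_[p]) ≠ 0 := by exact_mod_cast (Fact.out : p.Prime).ne_zero
  have hrew : (1 : ℚ_[p]) - (a : ℚ_[p]) * (p : ℚ_[p])⁻¹ =
      (((p : ℤ) - a : ℤ) : ℚ_[p]) * (p : ℚ_[p])⁻¹ := by
    push_cast
    field_simp
  have hnd : ¬ (p : ℤ) ∣ (p : ℤ) - a := fun h ↦
    ha (by simpa [sub_sub_cancel] using dvd_sub (dvd_refl (p : ℤ)) h)
  have hunit : ‖(((p : ℤ) - a : ℤ) : ℚ_[p])‖ = 1 :=
    le_antisymm (Padic.norm_int_le_one _) (not_lt.mp (mt Padic.norm_intCast_lt_one_iff.mp hnd))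
  rw [hrew, norm_mul, norm_inv, Padic.norm_p, inv_inv, hunit, one_mul]

end Receptacle

/-! ### §2 The algebra of EQUALITY (every prime `p`) -/

section Algebra

variable (p : ℕ) [Fact p.Prime]

/-- From a real equality between powers of `p` to the integer equality. [folklore] -/
theorem R1.eq_two_mul_sub_one_of_zpow_eq {n : ℕ} {v : ℤ}
    (h : (p : ℝ) ^ (-(n : ℤ)) = (p : ℝ) ^ 2 * ((p : ℝ) ^ (-v)) ^ 2) : (n : ℤ) = 2 * (v - 1) := by
  have hp1 : (1 : ℝ) < p := by exact_mod_cast (Fact.out : p.Prime).one_lt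
  have hp0 : (0 : ℝ) < p := by positivity
  have hrhs : (p : ℝ) ^ 2 * ((p : ℝ) ^ (-v)) ^ 2 = (p : ℝ) ^ (2 - 2 * v) := by
    rw [← zpow_natCast ((p : ℝ) ^ (-v)) 2, ← zpow_mul, ← zpow_natCast (p : ℝ) 2,
      ← zpow_add₀ hp0.ne']
    congr 1
    push_cast
    ring
  rw [hrhs, zpow_right_inj₀ hp0 hp1.ne'] at h
  omega

/-- **The algebra of EQUALITY.** If `f ∈ Λ = ℤ_p⟦T⟧` has non-zero constant term, its image in
`R₀⟦T⟧` (along a norm-compatible `φ : ℤ_p → R₀`) GENERATES the same ideal as `L` — `(f)·R₀⟦T⟧ = (L)`,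
the main conjecture read on generators — and `L(0) = u·((1 − a p⁻¹)·x)²` with `u ∈ R₀ˣ` and `p ∤ a`
(the value formula), then `x ≠ 0` and `ord_p f(0) = 2·(ord_p x − 1)` EXACTLY. Proof by norms in `ℂ_p`:
`f ↦ v·L` with `v` a UNIT of `R₀⟦T⟧` (a domain), so `‖f(0)‖ = ‖v(0)‖·‖L(0)‖ = ‖L(0)‖ =
‖u‖·‖1 − a/p‖²·‖x‖² = p²‖x‖²`. [folklore] -/
theorem R1.valuation_constantCoeff_eq_of_span_map_eq {f : IwasawaAlgebra p}
    (hf0 : constantCoeff f ≠ 0) (φ : ℤ_[p] →+* unrIntegers p)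
    (hφ : ∀ z : ℤ_[p], ((φ z : unrIntegers p) : ℂ_[p]) = algebraMap ℚ_[p] ℂ_[p] (z : ℚ_[p]))
    {L : UnrSeries p}
    (hfL : Ideal.span {PowerSeries.map φ f} = Ideal.span ({L} : Set (UnrSeries p)))
    (u : (unrIntegers p)ˣ) {a : ℤ} (ha : ¬ (p : ℤ) ∣ a) {x : ℚ_[p]}
    (hL : L.HasValueAt 0 (((u : unrIntegers p) : ℂ_[p]) *
      (algebraMap ℚ_[p] ℂ_[p] (((1 : ℚ_[p]) - (a : ℚ_[p]) * (p : ℚ_[p])⁻¹) * x)) ^ 2)) :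
    x ≠ 0 ∧ ((constantCoeff f).valuation : ℤ) = 2 * (x.valuation - 1) := by
  set y : ℚ_[p] := ((1 : ℚ_[p]) - (a : ℚ_[p]) * (p : ℚ_[p])⁻¹) * x with hy
  -- `L(0)` is the constant term
  have hL0 : ((u : unrIntegers p) : ℂ_[p]) * (algebraMap ℚ_[p] ℂ_[p] y) ^ 2 =
      ((constantCoeff L : unrIntegers p) : ℂ_[p]) :=
    UnrSeries.eq_constantCoeff_of_hasValueAt_zero hL
  -- `map φ f = L · v` with `v` a unit
  obtain ⟨v, hv⟩ := Ideal.span_singleton_eq_span_singleton.mp hfL.symm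
  have hv0 : ‖((constantCoeff (v : UnrSeries p) : unrIntegers p) : ℂ_[p])‖ = 1 := by
    obtain ⟨w, hw⟩ := PowerSeries.isUnit_constantCoeff (v : UnrSeries p) v.isUnit
    rw [← hw]
    exact norm_coe_units_unrIntegers p w
  have hfac : algebraMap ℚ_[p] ℂ_[p] ((constantCoeff f : ℤ_[p]) : ℚ_[p]) =
      ((constantCoeff L : unrIntegers p) : ℂ_[p]) *
        ((constantCoeff (v : UnrSeries p) : unrIntegers p) : ℂ_[p]) := by
    rw [← hφ, ← constantCoeff_map_apply φ f, ← hv, map_mul, Subring.coe_mul]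
  -- norms
  have hp1 : (1 : ℝ) < p := by exact_mod_cast (Fact.out : p.Prime).one_lt
  have hp0 : (0 : ℝ) < p := by positivity
  have hnormf : ‖((constantCoeff f : ℤ_[p]) : ℚ_[p])‖ = (p : ℝ) ^ 2 * ‖x‖ ^ 2 := by
    calc ‖((constantCoeff f : ℤ_[p]) : ℚ_[p])‖
        = ‖algebraMap ℚ_[p] ℂ_[p] ((constantCoeff f : ℤ_[p]) : ℚ_[p])‖ :=
          (norm_algebraMap' ℂ_[p] _).symm
      _ = ‖((constantCoeff L : unrIntegers p) : ℂ_[p])‖ := by rw [hfac, norm_mul, hv0, mul_one]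
      _ = ‖algebraMap ℚ_[p] ℂ_[p] y‖ ^ 2 := by
          rw [← hL0, norm_mul, norm_pow, norm_coe_units_unrIntegers, one_mul]
      _ = ‖y‖ ^ 2 := by rw [norm_algebraMap']
      _ = ((p : ℝ) * ‖x‖) ^ 2 := by rw [hy, norm_mul, R1.norm_one_sub_div_eq p ha]
      _ = (p : ℝ) ^ 2 * ‖x‖ ^ 2 := by ring
  -- `x ≠ 0`
  have hx0 : x ≠ 0 := by
    intro hx
    rw [hx, norm_zero, zero_pow two_ne_zero, mul_zero] at hnormf
    exact hf0 (PadicInt.coe_eq_zero.mp (norm_eq_zero.mp hnormf))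
  refine ⟨hx0, R1.eq_two_mul_sub_one_of_zpow_eq p ?_⟩
  rwa [← PadicInt.norm_def, PadicInt.norm_eq_zpow_neg_valuation hf0,
    Padic.norm_eq_zpow_neg_valuation hx0] at hnormf

end Algebra

/-! ### §3 Pointwise on tree objects (every `p`, every embedding `ι : K → ℚ_p`) -/

section Pointwise

variable {K : Type} [Field K] [NumberField K] (W : WeierstrassCurve ℚ) [W.IsElliptic]
  [W.IsGloballyMinimal] (p : ℕ) [Fact p.Prime] (ι : K →+* ℚ_[p])
  (P : (W.baseChange K).toAffine.Point)

variable (κ : ZpExtension K p) (𝔭 : HeightOneSpectrum (𝓞 K)) (γ : Field.absoluteGaloisGroup K)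
  [Fact (κ.IsTopGenerator γ)]

/-- **H2 — (BDP) at `𝟙`, Cas18 Thm. 3.2 SHAPE at a frame `L`** ("the following equality holds up to
a `p`-adic unit: `L_p(f, 𝟙) = (1 − a_p p⁻¹ + ε_p)²·(log_{ω_E} P_K)²`", `ε_p = 0` at `p ∣ N`): the value
of `L ∈ R₀⟦T⟧` at the trivial character (`T = 0`) is `u·((1 − a·p⁻¹)·log_{ω_E} P)²` for a UNIT `u`
of `R₀`, with `a` meant to be `a_p(E)` (`W.LFunction p`, `= ±1` at multiplicative `p`) and `L` meant
to be Castella's `L_p(f)` (a frame `IsBDPLFunction … L`). A predicate; nothing asserted; PUB shape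
(printed proof at `p ∣ N`: [cas-split] Thm. 2.11, split `p ≥ 5` — x11b3 REFEREE §2 H3/H4).
[cite: Castella2018, Thm. 3.2 (arXiv:1704.06608 p. 9) (shape only; nothing asserted)] -/
def R1.BDPValueAtOneOnTreeAt (L : UnrSeries p) (a : ℤ) : Prop :=
  ∃ u : (unrIntegers p)ˣ, L.HasValueAt 0 (((u : unrIntegers p) : ℂ_[p]) *
    (algebraMap ℚ_[p] ℂ_[p] (((1 : ℚ_[p]) - (a : ℚ_[p]) * (p : ℚ_[p])⁻¹) * logOmega W p ι P)) ^ 2)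

/-- **H3 — (IMC), erratum Thm. 1.1 SHAPE at a frame `L`** ("`X_ac(E[p^∞])` is `Λ`-torsion, and
`Ch_Λ(X_ac(E[p^∞]))Λ_{R₀} = (L_p(f))`", here the EQUALITY of ideals of `Λ_{R₀} = R₀⟦T⟧` for the
constructed `X_ac^∅(E[p^∞])` of `AnticyclotomicSelmerDual` — torsion being part of CTL₀): the image
of `Ch_Λ(X_ac)` under `Λ → Λ_{R₀}` generates `(L)`. THE OPEN statement of route R1 for Castella's
`L_p(f)` (UNREFEREED ⇐ [FW21, Thm. 4.41], PREPRINT). A predicate; NEVER a theorem here.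
[claim: Castella2018Erratum, status: under-review] -/
def R1.IMCEqOnTreeAt (L : UnrSeries p) : Prop :=
  (XAc.charIdeal (W.baseChange K) p κ 𝔭 ∅ γ).map (PowerSeries.map (toUnr p)) =
    Ideal.span {L}

variable {W p ι P κ 𝔭 γ}

/-- **HALVES ⟹ the composite, pointwise (every `p`).** CTL₀ (`HasCharValuationAt … n`: `X_ac` torsion
with a generator of non-zero constant term of valuation `n`) ∧ H3 (`Ch_Λ(X_ac)·R₀⟦T⟧ = (L)`) ∧ H2
(`L(𝟙) = u·((1 − a/p)·log_{ω_E} P)²`, `p ∤ a`) ⟹ route R1's composite open link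
`IMCWaldspurgerOnTreeAt p κ 𝔭 γ ι P` with the SAME `n` (`= 2·(ord_p log_ω P − 1)`); `log_ω P ≠ 0`
comes out, it is not put in. [cite: Castella2018, §5 (5.1) (arXiv:1704.06608 p. 12)]
[cite: Castella2018Erratum, Thm. 1.1 (p. 1)] -/
theorem R1.imcWaldspurgerOnTreeAt_of_halves {n : ℕ}
    (hn : XAc.HasCharValuationAt (W.baseChange K) p κ 𝔭 ∅ γ n) {L : UnrSeries p}
    (h3 : R1.IMCEqOnTreeAt W p κ 𝔭 γ L) {a : ℤ} (ha : ¬ (p : ℤ) ∣ a)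
    (h2 : R1.BDPValueAtOneOnTreeAt W p ι P L a) : IMCWaldspurgerOnTreeAt p κ 𝔭 γ ι P := by
  obtain ⟨htors, f, hf, hf0, hfn⟩ := hn
  obtain ⟨u, hu⟩ := h2
  have hspan : Ideal.span {PowerSeries.map (toUnr p) f} =
      Ideal.span ({L} : Set (UnrSeries p)) := by
    rw [R1.IMCEqOnTreeAt, hf, Ideal.map_span, Set.image_singleton] at h3
    exact h3
  obtain ⟨hx0, hval⟩ := R1.valuation_constantCoeff_eq_of_span_map_eq p hf0 (toUnr p)
    (coe_toUnr p) hspan u ha hu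
  refine ⟨n, ⟨htors, f, hf, hf0, hfn⟩, ?_⟩
  rw [← valuation_logOmega hx0, ← hfn]
  exact hval

omit [W.IsElliptic] [W.IsGloballyMinimal] in
/-- `a_p(E) = ±1` at a prime of multiplicative reduction, read off the newform of `E` (tree:
`IsNewformOf.cuspCoeff_eq_one_and_sq_of_split`, `IsNewformOf.cuspCoeff_eq_neg_one_and_dvd_of_nonsplit`);
in particular `p ∤ a_p(E)`. [cite: Silverman1994, IV.10.2 (a_p = ±1 at multiplicative p)] -/
theorem R1.not_dvd_lFunction_of_mult {N : ℕ} [NeZero N] {f : CuspForm (CongruenceSubgroup.Gamma0 N) 2}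
    (hf : IsNewformOf W f) (hmult : Mult W p) : ¬ (p : ℤ) ∣ W.LFunction p := by
  have hp2 : (2 : ℤ) ≤ p := by exact_mod_cast (Fact.out : p.Prime).two_le
  have h1 : W.LFunction p = 1 ∨ W.LFunction p = -1 := by
    by_cases hsplit : W.HasSplitMultiplicativeReductionAtPrime p
    · left
      have h := (hf.cuspCoeff_eq_one_and_sq_of_split hsplit).1
      rw [hf.2 p] at h
      exact_mod_cast h
    · right
      have h := (hf.cuspCoeff_eq_neg_one_and_dvd_of_nonsplit hmult hsplit).1
      rw [hf.2 p] at h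
      exact_mod_cast h
  rintro ⟨c, hc⟩
  rcases h1 with h | h <;> rw [h] at hc
  · have := Int.eq_one_of_mul_eq_one_right (by positivity) hc.symm
    omega
  · have h' : (p : ℤ) * (-c) = 1 := by linarith
    have := Int.eq_one_of_mul_eq_one_right (by positivity) h'
    omega

end Pointwise

end Summit.BirchSwinnertonDyer.Rank1Residual.X11b

end
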